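import Literature.NumberTheory.LFunctions.WeilFirstPrimeCertificateDataA
import HarnessLib

/-!
# First-prime Weil positivity on `C(2/5)`: kernel checks of the cells and the scalars

Sibling of `WeilFirstPrimeCertificateDataA.lean`: the cheap parts of `weilCert2A.check`
evaluated by `decide +kernel` — the 43 cells of the minorant (in 3 chunks), the chain and level
test (`checkCells₂`) and the scalar side conditions (`checkScalars`, including `κ ≥ 0`). The table of
moments is checked in `…ANu*.lean`, the parity blocks in `…ABlock0.lean` / `…ABlock1.lean`.
The kernel evaluations are run one after the other (`Elab.async false`): run in parallel they exhaust memory.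
-/

set_option Elab.async false

noncomputable section

namespace Literature.NumberTheory.LFunctions

/-- Kernel check of the cells, chunk `1/3`. [folklore] -/
theorem weilCert2ACells1_check :
    (weilCert2ACells1.all fun c ↦ c.check 96) = true := by
  decide +kernel

/-- Kernel check of the cells, chunk `2/3`. [folklore] -/
theorem weilCert2ACells2_check :
    (weilCert2ACells2.all fun c ↦ c.check 96) = true := by
  decide +kernel

/-- Kernel check of the cells, chunk `3/3`. [folklore] -/
theorem weilCert2ACells3_check :
    (weilCert2ACells3.all fun c ↦ c.check 96) = true := by
  decide +kernel

/-- All cells pass. [folklore] -/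
theorem weilCert2ACells_check : (weilCert2ACells.all fun c ↦ c.check 96) = true := by
  simp only [weilCert2ACells, List.all_append, weilCert2ACells1_check, weilCert2ACells2_check, weilCert2ACells3_check, Bool.and_self]

/-- **Kernel check of the minorant** (`checkCells₂`: chain from `0` to `T`, all cells, level test at `T`). [folklore] -/
theorem checkCells₂_weilCert2A :
    checkCells₂ weilCert2A.base.prec weilCert2A.base.wL weilCert2A.base.T weilCert2A.base.mwT
      weilCert2A.cells = true := by
  have h1 : checkChain₂ weilCert2ACells 0 33 = true := by decide +kernel
  have h3 : decide (weilCert2A.base.wL + cZeroFI.hiQ ≤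
      wLoQ weilCert2A.base.prec weilCert2A.base.T weilCert2A.base.mwT) = true := by
    decide +kernel
  change (checkChain₂ weilCert2ACells 0 33 && (weilCert2ACells.all fun c ↦ c.check 96) &&
    decide (weilCert2A.base.wL + cZeroFI.hiQ ≤
      wLoQ weilCert2A.base.prec weilCert2A.base.T weilCert2A.base.mwT)) = true
  rw [h1, h3, weilCert2ACells_check]
  rfl

/-- **Kernel check of the scalar side conditions** (`0 < b ≤ a₀ ≤ 1`, cut-off vs `N`, Taylor remainder,
`N + 1` even, `κ ≥ 0`). [folklore] -/
theorem checkScalars_weilCert2A : weilCert2A.checkScalars = true := by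
  decide +kernel

end Literature.NumberTheory.LFunctions
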